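import Mathlib
import Literature.MathematicalPhysics.QuantumFieldTheory.OSSectorContinuation

/-!
# Triage check (crux stmt-QuantumFields-9664, cards `two-mirror-lightcone-slots` / `lightcone-sector-engine`)

The first lemma of card `two-mirror-lightcone-slots` (`Sketch.twoSlot_sector_extension_sharp`, sorried by the
ideator) is a COROLLARY of the tree's proved `LogSlot.IsSectorData.exists_extension` +
`LogSlot.IsSectorData.norm_extension_le` (OSSectorContinuation.lean) at `m = 1`, `p = 0`, constant `Csec = M`.
This file proves it, confirming "Leans on" is as strong as used and that the two cards share one lever.
-/

noncomputable section

open Complex Set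
open Literature.Analysis.Complex Literature.MathematicalPhysics.QuantumFieldTheory.LogSlot

namespace TriageTwoSlot

theorem twoSlot_sector_extension_sharp
    (φ : ℝ → ℝ → ℂ) (E₁ E₂ : ℝ → ℂ → ℂ) (M : ℝ)
    (hφc : Continuous (Function.uncurry φ))
    (hφb : ∀ u u' : ℝ, 0 ≤ u → 0 ≤ u' → ‖φ u u'‖ ≤ M)
    (hE₁d : ∀ u' : ℝ, 0 ≤ u' → DifferentiableOn ℂ (E₁ u') {τ : ℂ | 0 < τ.re})
    (hE₂d : ∀ u : ℝ, 0 ≤ u → DifferentiableOn ℂ (E₂ u) {τ : ℂ | 0 < τ.re})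
    (hE₁c : ∀ τ : ℂ, 0 < τ.re → Continuous fun u' : ℝ => E₁ u' τ)
    (hE₂c : ∀ τ : ℂ, 0 < τ.re → Continuous fun u : ℝ => E₂ u τ)
    (hE₁b : ∀ u' : ℝ, 0 ≤ u' → ∀ τ : ℂ, 0 < τ.re → ‖E₁ u' τ‖ ≤ M)
    (hE₂b : ∀ u : ℝ, 0 ≤ u → ∀ τ : ℂ, 0 < τ.re → ‖E₂ u τ‖ ≤ M)
    (hE₁φ : ∀ u' : ℝ, 0 ≤ u' → ∀ x : ℝ, 0 < x → E₁ u' (x : ℂ) = φ x u')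
    (hE₂φ : ∀ u : ℝ, 0 ≤ u → ∀ x : ℝ, 0 < x → E₂ u (x : ℂ) = φ u x) :
    ∃ G : (Fin 2 → ℂ) → ℂ,
      DifferentiableOn ℂ G (sectorRegion 1 (Real.pi / 2)) ∧
      (∀ u u' : ℝ, 0 < u → 0 < u' → G ![(u : ℂ), (u' : ℂ)] = φ u u') ∧
      ∀ w ∈ sectorRegion 1 (Real.pi / 2), ‖G w‖ ≤ M := by
  -- the data in the engine's format (`m = 1`)
  set S : (Fin 2 → ℝ) → ℂ := fun u => φ (u 0) (u 1) with hS
  set E : Fin 2 → (Fin 1 → ℝ) → ℂ → ℂ := ![fun u' τ => E₁ (u' 0) τ, fun u' τ => E₂ (u' 0) τ]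
    with hE
  have hM : 0 ≤ M := (norm_nonneg _).trans (hφb 0 0 le_rfl le_rfl)
  have hsec : ∀ {a : ℝ} {τ : ℂ}, τ ∈ openSector a → 0 < τ.re := fun h => h.1
  have hdata : IsSectorData (Real.pi / 2) S E M 0 (fun _ => M) := by
    refine ⟨?_, hM, ?_, ?_, ?_, fun _ => hM, ?_, ?_⟩
    · -- continuity on the open orthant
      have : Continuous S :=
        hφc.comp (Continuous.prodMk (continuous_apply 0) (continuous_apply 1))
      exact this.continuousOn
    · intro u hu
      rw [pow_zero, mul_one]
      exact hφb _ _ (hu 0).le (hu 1).le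
    · intro i τ hτ
      have h0 : 0 < τ.re := hsec hτ
      fin_cases i
      · simp only [hE, Fin.zero_eta, Fin.isValue, Matrix.cons_val_zero]
        exact ((hE₁c τ h0).comp (continuous_apply 0)).continuousOn
      · simp only [hE, Fin.mk_one, Fin.isValue, Matrix.cons_val_one, Matrix.cons_val_fin_one]
        exact ((hE₂c τ h0).comp (continuous_apply 0)).continuousOn
    · intro i u' hu'
      fin_cases i
      · simpa [hE] using (hE₁d (u' 0) (hu' 0).le).mono fun τ hτ => hsec hτ
      · simpa [hE] using (hE₂d (u' 0) (hu' 0).le).mono fun τ hτ => hsec hτ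
    · intro i c _ u' τ hu' hτ _
      rw [pow_zero, pow_zero, mul_one, mul_one]
      fin_cases i
      · simpa [hE] using hE₁b (u' 0) (hu' 0).le τ hτ
      · simpa [hE] using hE₂b (u' 0) (hu' 0).le τ hτ
    · intro i u' hu' x hx
      fin_cases i
      · simp [hE, hS, hE₁φ (u' 0) (hu' 0).le x hx]
      · have h0 : (1 : Fin 2).succAbove (0 : Fin 1) = 0 := by decide
        have h0' : Fin.insertNth (α := fun _ : Fin 2 => ℝ) (1 : Fin 2) x u' 0 = u' 0 := by
          conv_lhs => rw [← h0]
          rw [Fin.insertNth_apply_succAbove]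
        simp [hE, hS, hE₂φ (u' 0) (hu' 0).le x hx, h0']
  obtain ⟨G, hG, hGreal⟩ := hdata.exists_extension (by positivity) le_rfl
  refine ⟨G, hG, fun u u' hu hu' => ?_, fun w hw => ?_⟩
  · have h := hGreal ![u, u'] (fun j => by fin_cases j <;> simpa)
    have hv : (fun j : Fin 2 => ((![u, u'] j : ℝ) : ℂ)) = ![(u : ℂ), (u' : ℂ)] := by
      funext j; fin_cases j <;> simp
    rw [hv] at h
    rw [h]
    simp [hS]
  · obtain ⟨c, hc1, hc2⟩ := exists_between hw.2
    have hc0 : 0 < c := lt_of_le_of_lt (Finset.sum_nonneg fun j _ => abs_nonneg _) hc1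
    exact hdata.norm_extension_le le_rfl hG hGreal hc0 hc2
      (fun u hu => hφb _ _ (hu 0).le (hu 1).le)
      (fun i u' τ hu' hτ _ => by
        fin_cases i
        · simpa [hE] using hE₁b (u' 0) (hu' 0).le τ hτ
        · simpa [hE] using hE₂b (u' 0) (hu' 0).le τ hτ)
      ⟨hw.1, hc1⟩

end TriageTwoSlot
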